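import Mathlib
import Summits.Ventures.PercRepro2.HCov
import Summits.Ventures.PercRepro2.A3RootEdge
import Summits.Ventures.PercRepro2.RootEdgeBern
import Summits.Ventures.PercRepro2.HCovPlusQuartic
import Summits.Ventures.PercRepro2.QuarticRootCross
import Summits.Ventures.PercRepro2.QuarticRootCrossOL
import Summits.Ventures.PercRepro2.QuarticRootSlack

/-!
# THE ROOT-EDGE FACE OF THE QUARTIC SPLIT INTO A NON-`O(t)` PART AND AN `O(t)` PART
(blind cell PercRepro2, p5 g19; `proofs/P5-OEDGE.md` §25)

At a root edge `e = {a₁, a₃}`, in the closed pin's masses (`d = P₀(PD)`, `t = P₀(T)`, `t′ = P₀(T′)`,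
`pL / pH / p3 = P₀(PD, bL / bH / b ↔ a₃)`, `tL / tH = P₀(T, bL / bH)`, `t′L / t′H = P₀(T′, bL / bH)`),
the four BHK pieces of `slackBm` (`QuarticRootSlackSign`) are
`G1 = tH·(d + t′) − t·(pH + t′H)`, `G2 = t·(pL + t′L) − tL·(d + t′)`, `G3 = δ_bH = t′·pH − d·t′H`,
`G4 = t·p3`, and the root-edge pieces of `A3RootEdge` read

* **`df_eq_root`** (I7): `df = G1 + G2 + Q₀·p3` — hence `slackBm = 2·(G1 + G2 + G3 + G4)`
  (**`slackBm_root_four_pieces`**) and `G1 + G2 + G4 = df − Q₁·p3`;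
* **`dg_eq_root`** (I3): `dg = 2·Q₁·δ_oL^T + 2·t·δ_oH`, `δ_oL^T = P₀(PD, oL)·t − D₀·P₀(T, oL)`,
  `δ_oH = P₀(PD, oH)·t′ − D₀·P₀(T′, oH)`;
* **`dg_add_two_Q0_covUm`** (I8): `dg + 2·Q₀·c = 2·Q₀·A + 2·Q₁·(δ_oL^T − δ_oH)` with
  `A = D₀·P₀(PD, o ↔ a₃) + δ'_oL` the positive part of the cross term (`c = A − δ_oH`).

So `Q₀·H2 = 2·D₀·Q₀²·g₁ + (N1) + (N2)` (**`Q0_mul_H2_root_split`**) with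
**(N1)** `= Q₁²·Gc₀ + 2·Q₀·c·G3` (no `O(t)` piece) and **(N2)** `= df·dg + 2·Q₀·c·(G1 + G2 + G4)`
(every piece `O(t)`), and `(N2)/2 = Q₁·df·δ_oL^T + Q₀·A·(G1 + G2 + G4) − Q₁·δ_oH·(G1 + G2)`
(**`N2_eq_root`**, (I9)); **`H2_nonneg_root_of_split`**: `0 ≤ (N1)`, `0 ≤ (N2)` and `0 < Q₀` give
`0 ≤ H2`. Identities only — no sign of (N1) or (N2) is claimed (both are census statements, §25).
-/

namespace Summit.Ventures.PercRepro2

open UnionCluster CovForm CovForm.EdgeLine CovForm.RootEdge HCovPlusQuartic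

namespace QuarticRootCross

section Split

variable {V : Type*} {E : Type*} [Fintype V] [DecidableEq V] [Fintype E] [DecidableEq E]
  {R : Type*} [Field R] [LinearOrder R] [IsStrictOrderedRing R]

variable {ends : E → Sym2 V} {e : E} {a₁ a₃ : V}

omit [Fintype V] [LinearOrder R] [IsStrictOrderedRing R] in
/-- **(I7) `df = G1 + G2 + Q₀·p3`** at a root edge: the signed piece of `A3RootEdge` in closed-pin
masses. -/
theorem df_eq_root (p : E → R) (hends : ends e = s(a₁, a₃)) (a₂ b : V) :
    prob (Function.update p e 0) (avoidAll ends a₂ {a₁}) *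
          (prob (Function.update p e 1) (avoidAll ends a₂ {a₁} ∩ connEvent ends a₁ b) -
            prob (Function.update p e 1) (avoidAll ends a₂ {a₁} ∩ connEvent ends a₂ b)) -
        prob (Function.update p e 1) (avoidAll ends a₂ {a₁}) *
          (prob (Function.update p e 0) (avoidAll ends a₂ {a₁} ∩ connEvent ends a₁ b) -
            prob (Function.update p e 0) (avoidAll ends a₂ {a₁} ∩ connEvent ends a₂ b)) =
      (prob (Function.update p e 0) (TEvent ends a₁ a₂ a₃ ∩ connEvent ends a₂ b) *
            (prob (Function.update p e 0) (PDEvent ends a₁ a₂ a₃) +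
              prob (Function.update p e 0) (TEvent ends a₂ a₁ a₃)) -
          prob (Function.update p e 0) (TEvent ends a₁ a₂ a₃) *
            (prob (Function.update p e 0) (PDEvent ends a₁ a₂ a₃ ∩ connEvent ends a₂ b) +
              prob (Function.update p e 0) (TEvent ends a₂ a₁ a₃ ∩ connEvent ends a₂ b))) +
        (prob (Function.update p e 0) (TEvent ends a₁ a₂ a₃) *
            (prob (Function.update p e 0) (PDEvent ends a₁ a₂ a₃ ∩ connEvent ends a₁ b) +
              prob (Function.update p e 0) (TEvent ends a₂ a₁ a₃ ∩ connEvent ends a₁ b)) -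
          prob (Function.update p e 0) (TEvent ends a₁ a₂ a₃ ∩ connEvent ends a₁ b) *
            (prob (Function.update p e 0) (PDEvent ends a₁ a₂ a₃) +
              prob (Function.update p e 0) (TEvent ends a₂ a₁ a₃))) +
        prob (Function.update p e 0) (avoidAll ends a₂ {a₁}) *
          prob (Function.update p e 0) (PDEvent ends a₁ a₂ a₃ ∩ connEvent ends a₃ b) := by
  rw [prob_one_Q_root_split p hends a₂, prob_one_Q_bL_root_split p hends a₂ b,
    prob_one_Q_bH_root_split p hends a₂ b,
    Qsplit (Function.update p e 0) ends a₁ a₂ a₃ (connEvent ends a₁ b),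
    Qsplit (Function.update p e 0) ends a₁ a₂ a₃ (connEvent ends a₂ b),
    Qsplit_univ (Function.update p e 0) ends a₁ a₂ a₃]
  ring

omit [Fintype V] in
/-- **`slackBm = 2·(G1 + G2 + G3 + G4)`** at a root edge — the four BHK pieces of
`QuarticRootSlackSign`, as an identity. -/
theorem slackBm_root_four_pieces (p : E → R) (hends : ends e = s(a₁, a₃)) (a₂ b : V) :
    slackBm p ends a₁ a₂ a₃ b e =
      2 * ((prob (Function.update p e 0) (TEvent ends a₁ a₂ a₃ ∩ connEvent ends a₂ b) *
            (prob (Function.update p e 0) (PDEvent ends a₁ a₂ a₃) +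
              prob (Function.update p e 0) (TEvent ends a₂ a₁ a₃)) -
          prob (Function.update p e 0) (TEvent ends a₁ a₂ a₃) *
            (prob (Function.update p e 0) (PDEvent ends a₁ a₂ a₃ ∩ connEvent ends a₂ b) +
              prob (Function.update p e 0) (TEvent ends a₂ a₁ a₃ ∩ connEvent ends a₂ b))) +
        (prob (Function.update p e 0) (TEvent ends a₁ a₂ a₃) *
            (prob (Function.update p e 0) (PDEvent ends a₁ a₂ a₃ ∩ connEvent ends a₁ b) +
              prob (Function.update p e 0) (TEvent ends a₂ a₁ a₃ ∩ connEvent ends a₁ b)) -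
          prob (Function.update p e 0) (TEvent ends a₁ a₂ a₃ ∩ connEvent ends a₁ b) *
            (prob (Function.update p e 0) (PDEvent ends a₁ a₂ a₃) +
              prob (Function.update p e 0) (TEvent ends a₂ a₁ a₃))) +
        (prob (Function.update p e 0) (TEvent ends a₂ a₁ a₃) *
              prob (Function.update p e 0) (PDEvent ends a₁ a₂ a₃ ∩ connEvent ends a₂ b) -
            prob (Function.update p e 0) (PDEvent ends a₁ a₂ a₃) *
              prob (Function.update p e 0) (TEvent ends a₂ a₁ a₃ ∩ connEvent ends a₂ b)) +
        prob (Function.update p e 0) (TEvent ends a₁ a₂ a₃) *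
          prob (Function.update p e 0) (PDEvent ends a₁ a₂ a₃ ∩ connEvent ends a₃ b)) := by
  rw [slackBm_root_decomp p hends a₂ b, df_eq_root p hends a₂ b, prob_one_Q_root_split p hends a₂,
    Qsplit_univ (Function.update p e 0) ends a₁ a₂ a₃]
  ring

omit [Fintype V] [LinearOrder R] [IsStrictOrderedRing R] in
/-- **(I3) `dg = 2·Q₁·δ_oL^T + 2·t·δ_oH`** at a root edge: the `o`-piece of `A3RootEdge`
(`Do₀·Q₀·Q₁ − 2·P₁(Q, oH)·D₀·Q₀ − DEF₀·Q₁`) in closed-pin masses. -/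
theorem dg_eq_root (p : E → R) (hends : ends e = s(a₁, a₃)) (o a₂ : V) :
    Do (Function.update p e 0) ends o a₁ a₂ a₃ * prob (Function.update p e 0) (avoidAll ends a₂ {a₁}) *
          prob (Function.update p e 1) (avoidAll ends a₂ {a₁}) -
        2 * prob (Function.update p e 1) (avoidAll ends a₂ {a₁} ∩ connEvent ends a₂ o) *
          prob (Function.update p e 0) (PDEvent ends a₁ a₂ a₃) *
          prob (Function.update p e 0) (avoidAll ends a₂ {a₁}) -
        DEF (Function.update p e 0) ends o a₁ a₂ a₃ * prob (Function.update p e 1) (avoidAll ends a₂ {a₁}) =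
      2 * prob (Function.update p e 1) (avoidAll ends a₂ {a₁}) *
          (prob (Function.update p e 0) (PDEvent ends a₁ a₂ a₃ ∩ connEvent ends a₁ o) *
              prob (Function.update p e 0) (TEvent ends a₁ a₂ a₃) -
            prob (Function.update p e 0) (PDEvent ends a₁ a₂ a₃) *
              prob (Function.update p e 0) (TEvent ends a₁ a₂ a₃ ∩ connEvent ends a₁ o)) +
        2 * prob (Function.update p e 0) (TEvent ends a₁ a₂ a₃) *
          (prob (Function.update p e 0) (PDEvent ends a₁ a₂ a₃ ∩ connEvent ends a₂ o) *
              prob (Function.update p e 0) (TEvent ends a₂ a₁ a₃) -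
            prob (Function.update p e 0) (PDEvent ends a₁ a₂ a₃) *
              prob (Function.update p e 0) (TEvent ends a₂ a₁ a₃ ∩ connEvent ends a₂ o)) := by
  unfold DEF EQo EQ3 EQ3o Do
  rw [prob_one_Q_root_split p hends a₂, prob_one_Q_bH_root_split p hends a₂ o,
    Qsplit (Function.update p e 0) ends a₁ a₂ a₃ (connEvent ends a₁ o),
    Qsplit (Function.update p e 0) ends a₁ a₂ a₃ (connEvent ends a₂ o),
    Qsplit_univ (Function.update p e 0) ends a₁ a₂ a₃]
  ring

omit [Fintype V] [LinearOrder R] [IsStrictOrderedRing R] in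
/-- **(I8) `dg + 2·Q₀·c = 2·Q₀·A + 2·Q₁·(δ_oL^T − δ_oH)`** at a root edge, `A = D₀·P₀(PD, o ↔ a₃) + δ'_oL`
the positive part of the cross term `c = covUm`. -/
theorem dg_add_two_Q0_covUm (p : E → R) (hends : ends e = s(a₁, a₃)) (o a₂ : V) :
    (Do (Function.update p e 0) ends o a₁ a₂ a₃ * prob (Function.update p e 0) (avoidAll ends a₂ {a₁}) *
          prob (Function.update p e 1) (avoidAll ends a₂ {a₁}) -
        2 * prob (Function.update p e 1) (avoidAll ends a₂ {a₁} ∩ connEvent ends a₂ o) *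
          prob (Function.update p e 0) (PDEvent ends a₁ a₂ a₃) *
          prob (Function.update p e 0) (avoidAll ends a₂ {a₁}) -
        DEF (Function.update p e 0) ends o a₁ a₂ a₃ * prob (Function.update p e 1) (avoidAll ends a₂ {a₁})) +
      2 * prob (Function.update p e 0) (avoidAll ends a₂ {a₁}) * covUm p ends o a₁ a₂ a₃ e =
      2 * prob (Function.update p e 0) (avoidAll ends a₂ {a₁}) *
          (prob (Function.update p e 0) (PDEvent ends a₁ a₂ a₃) *
              prob (Function.update p e 0) (PDEvent ends a₁ a₂ a₃ ∩ connEvent ends a₃ o) +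
            (prob (Function.update p e 0) (PDEvent ends a₁ a₂ a₃) *
                prob (Function.update p e 0) (TEvent ends a₂ a₁ a₃ ∩ connEvent ends a₁ o) -
              prob (Function.update p e 0) (PDEvent ends a₁ a₂ a₃ ∩ connEvent ends a₁ o) *
                prob (Function.update p e 0) (TEvent ends a₂ a₁ a₃))) +
        2 * prob (Function.update p e 1) (avoidAll ends a₂ {a₁}) *
          ((prob (Function.update p e 0) (PDEvent ends a₁ a₂ a₃ ∩ connEvent ends a₁ o) *
                prob (Function.update p e 0) (TEvent ends a₁ a₂ a₃) -
              prob (Function.update p e 0) (PDEvent ends a₁ a₂ a₃) *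
                prob (Function.update p e 0) (TEvent ends a₁ a₂ a₃ ∩ connEvent ends a₁ o)) -
            (prob (Function.update p e 0) (PDEvent ends a₁ a₂ a₃ ∩ connEvent ends a₂ o) *
                prob (Function.update p e 0) (TEvent ends a₂ a₁ a₃) -
              prob (Function.update p e 0) (PDEvent ends a₁ a₂ a₃) *
                prob (Function.update p e 0) (TEvent ends a₂ a₁ a₃ ∩ connEvent ends a₂ o))) := by
  rw [dg_eq_root p hends o a₂, covUm_root_decomp p hends o a₂]
  unfold Do
  rw [prob_one_Q_root_split p hends a₂, Qsplit_univ (Function.update p e 0) ends a₁ a₂ a₃]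
  ring

omit [Fintype V] in
/-- **`Q₀·H2 = 2·D₀·Q₀²·g₁ + (N1) + (N2)`** at a root edge: (N1) `= Q₁²·Gc₀ + 2·Q₀·c·G3` carries no
`O(t)` piece, (N2) `= df·dg + 2·Q₀·c·(G1 + G2 + G4)` is `O(t)` in every piece. -/
theorem Q0_mul_H2_root_split (p : E → R) (hends : ends e = s(a₁, a₃)) (o a₂ b : V) :
    prob (Function.update p e 0) (avoidAll ends a₂ {a₁}) * H2 p ends o a₁ a₂ a₃ b e =
      2 * prob (Function.update p e 0) (PDEvent ends a₁ a₂ a₃) *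
          prob (Function.update p e 0) (avoidAll ends a₂ {a₁}) ^ 2 *
          (-2 * (prob (Function.update p e 1) (avoidAll ends a₂ {a₁}) *
            (prob (Function.update p e 1)
                (avoidAll ends a₂ {a₁} ∩ (connEvent ends a₂ o ∩ connEvent ends a₁ b)) -
              prob (Function.update p e 1)
                (avoidAll ends a₂ {a₁} ∩ (connEvent ends a₂ o ∩ connEvent ends a₂ b))) -
          (prob (Function.update p e 1) (avoidAll ends a₂ {a₁} ∩ connEvent ends a₁ b) -
              prob (Function.update p e 1) (avoidAll ends a₂ {a₁} ∩ connEvent ends a₂ b)) *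
            prob (Function.update p e 1) (avoidAll ends a₂ {a₁} ∩ connEvent ends a₂ o))) +
        (prob (Function.update p e 1) (avoidAll ends a₂ {a₁}) ^ 2 *
            Gc (Function.update p e 0) ends o a₁ a₂ a₃ b +
          2 * prob (Function.update p e 0) (avoidAll ends a₂ {a₁}) * covUm p ends o a₁ a₂ a₃ e *
            (prob (Function.update p e 0) (TEvent ends a₂ a₁ a₃) *
                prob (Function.update p e 0) (PDEvent ends a₁ a₂ a₃ ∩ connEvent ends a₂ b) -
              prob (Function.update p e 0) (PDEvent ends a₁ a₂ a₃) *
                prob (Function.update p e 0) (TEvent ends a₂ a₁ a₃ ∩ connEvent ends a₂ b))) +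
        ((prob (Function.update p e 0) (avoidAll ends a₂ {a₁}) *
              (prob (Function.update p e 1) (avoidAll ends a₂ {a₁} ∩ connEvent ends a₁ b) -
                prob (Function.update p e 1) (avoidAll ends a₂ {a₁} ∩ connEvent ends a₂ b)) -
            prob (Function.update p e 1) (avoidAll ends a₂ {a₁}) *
              (prob (Function.update p e 0) (avoidAll ends a₂ {a₁} ∩ connEvent ends a₁ b) -
                prob (Function.update p e 0) (avoidAll ends a₂ {a₁} ∩ connEvent ends a₂ b))) *
          (Do (Function.update p e 0) ends o a₁ a₂ a₃ *
                prob (Function.update p e 0) (avoidAll ends a₂ {a₁}) *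
                prob (Function.update p e 1) (avoidAll ends a₂ {a₁}) -
              2 * prob (Function.update p e 1) (avoidAll ends a₂ {a₁} ∩ connEvent ends a₂ o) *
                prob (Function.update p e 0) (PDEvent ends a₁ a₂ a₃) *
                prob (Function.update p e 0) (avoidAll ends a₂ {a₁}) -
              DEF (Function.update p e 0) ends o a₁ a₂ a₃ *
                prob (Function.update p e 1) (avoidAll ends a₂ {a₁})) +
          2 * prob (Function.update p e 0) (avoidAll ends a₂ {a₁}) * covUm p ends o a₁ a₂ a₃ e *
            ((prob (Function.update p e 0) (TEvent ends a₁ a₂ a₃ ∩ connEvent ends a₂ b) *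
                (prob (Function.update p e 0) (PDEvent ends a₁ a₂ a₃) +
                  prob (Function.update p e 0) (TEvent ends a₂ a₁ a₃)) -
              prob (Function.update p e 0) (TEvent ends a₁ a₂ a₃) *
                (prob (Function.update p e 0) (PDEvent ends a₁ a₂ a₃ ∩ connEvent ends a₂ b) +
                  prob (Function.update p e 0) (TEvent ends a₂ a₁ a₃ ∩ connEvent ends a₂ b))) +
            (prob (Function.update p e 0) (TEvent ends a₁ a₂ a₃) *
                (prob (Function.update p e 0) (PDEvent ends a₁ a₂ a₃ ∩ connEvent ends a₁ b) +
                  prob (Function.update p e 0) (TEvent ends a₂ a₁ a₃ ∩ connEvent ends a₁ b)) -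
              prob (Function.update p e 0) (TEvent ends a₁ a₂ a₃ ∩ connEvent ends a₁ b) *
                (prob (Function.update p e 0) (PDEvent ends a₁ a₂ a₃) +
                  prob (Function.update p e 0) (TEvent ends a₂ a₁ a₃))) +
            prob (Function.update p e 0) (TEvent ends a₁ a₂ a₃) *
              prob (Function.update p e 0) (PDEvent ends a₁ a₂ a₃ ∩ connEvent ends a₃ b))) := by
  rw [Q0_mul_H2_root p hends o a₂ b, slackBm_root_four_pieces p hends a₂ b]
  ring

/-- **`0 ≤ H2` at a root edge from the split**: `0 ≤ (N1)`, `0 ≤ (N2)` and `0 < Q₀` give `0 ≤ H2`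
(the open pin's piece `2·D₀·Q₀²·g₁ = 2·Q₀²·B2 ≥ 0` is a theorem). -/
theorem H2_nonneg_root_of_split (p : E → R) (hp : IsProbVec p) (hends : ends e = s(a₁, a₃))
    (o a₂ b : V) (hQ : 0 < prob (Function.update p e 0) (avoidAll ends a₂ {a₁}))
    (hN1 : 0 ≤ prob (Function.update p e 1) (avoidAll ends a₂ {a₁}) ^ 2 *
            Gc (Function.update p e 0) ends o a₁ a₂ a₃ b +
          2 * prob (Function.update p e 0) (avoidAll ends a₂ {a₁}) * covUm p ends o a₁ a₂ a₃ e *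
            (prob (Function.update p e 0) (TEvent ends a₂ a₁ a₃) *
                prob (Function.update p e 0) (PDEvent ends a₁ a₂ a₃ ∩ connEvent ends a₂ b) -
              prob (Function.update p e 0) (PDEvent ends a₁ a₂ a₃) *
                prob (Function.update p e 0) (TEvent ends a₂ a₁ a₃ ∩ connEvent ends a₂ b)))
    (hN2 : 0 ≤ (prob (Function.update p e 0) (avoidAll ends a₂ {a₁}) *
              (prob (Function.update p e 1) (avoidAll ends a₂ {a₁} ∩ connEvent ends a₁ b) -
                prob (Function.update p e 1) (avoidAll ends a₂ {a₁} ∩ connEvent ends a₂ b)) -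
            prob (Function.update p e 1) (avoidAll ends a₂ {a₁}) *
              (prob (Function.update p e 0) (avoidAll ends a₂ {a₁} ∩ connEvent ends a₁ b) -
                prob (Function.update p e 0) (avoidAll ends a₂ {a₁} ∩ connEvent ends a₂ b))) *
          (Do (Function.update p e 0) ends o a₁ a₂ a₃ *
                prob (Function.update p e 0) (avoidAll ends a₂ {a₁}) *
                prob (Function.update p e 1) (avoidAll ends a₂ {a₁}) -
              2 * prob (Function.update p e 1) (avoidAll ends a₂ {a₁} ∩ connEvent ends a₂ o) *
                prob (Function.update p e 0) (PDEvent ends a₁ a₂ a₃) *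
                prob (Function.update p e 0) (avoidAll ends a₂ {a₁}) -
              DEF (Function.update p e 0) ends o a₁ a₂ a₃ *
                prob (Function.update p e 1) (avoidAll ends a₂ {a₁})) +
          2 * prob (Function.update p e 0) (avoidAll ends a₂ {a₁}) * covUm p ends o a₁ a₂ a₃ e *
            ((prob (Function.update p e 0) (TEvent ends a₁ a₂ a₃ ∩ connEvent ends a₂ b) *
                (prob (Function.update p e 0) (PDEvent ends a₁ a₂ a₃) +
                  prob (Function.update p e 0) (TEvent ends a₂ a₁ a₃)) -
              prob (Function.update p e 0) (TEvent ends a₁ a₂ a₃) *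
                (prob (Function.update p e 0) (PDEvent ends a₁ a₂ a₃ ∩ connEvent ends a₂ b) +
                  prob (Function.update p e 0) (TEvent ends a₂ a₁ a₃ ∩ connEvent ends a₂ b))) +
            (prob (Function.update p e 0) (TEvent ends a₁ a₂ a₃) *
                (prob (Function.update p e 0) (PDEvent ends a₁ a₂ a₃ ∩ connEvent ends a₁ b) +
                  prob (Function.update p e 0) (TEvent ends a₂ a₁ a₃ ∩ connEvent ends a₁ b)) -
              prob (Function.update p e 0) (TEvent ends a₁ a₂ a₃ ∩ connEvent ends a₁ b) *
                (prob (Function.update p e 0) (PDEvent ends a₁ a₂ a₃) +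
                  prob (Function.update p e 0) (TEvent ends a₂ a₁ a₃))) +
            prob (Function.update p e 0) (TEvent ends a₁ a₂ a₃) *
              prob (Function.update p e 0) (PDEvent ends a₁ a₂ a₃ ∩ connEvent ends a₃ b))) :
    0 ≤ H2 p ends o a₁ a₂ a₃ b e := by
  have hp₀ : IsProbVec (Function.update p e 0) := hp.update e le_rfl zero_le_one
  have hB2 := B2_nonneg_root p hp hends o a₂ b
  have hB2e := B2_eq_root p hends o a₂ b
  have hsplit := Q0_mul_H2_root_split p hends o a₂ b
  have hQ0 := prob_nonneg hp₀ (avoidAll ends a₂ {a₁})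
  have hg : 0 ≤ 2 * prob (Function.update p e 0) (PDEvent ends a₁ a₂ a₃) *
      prob (Function.update p e 0) (avoidAll ends a₂ {a₁}) ^ 2 *
      (-2 * (prob (Function.update p e 1) (avoidAll ends a₂ {a₁}) *
        (prob (Function.update p e 1)
            (avoidAll ends a₂ {a₁} ∩ (connEvent ends a₂ o ∩ connEvent ends a₁ b)) -
          prob (Function.update p e 1)
            (avoidAll ends a₂ {a₁} ∩ (connEvent ends a₂ o ∩ connEvent ends a₂ b))) -
      (prob (Function.update p e 1) (avoidAll ends a₂ {a₁} ∩ connEvent ends a₁ b) -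
          prob (Function.update p e 1) (avoidAll ends a₂ {a₁} ∩ connEvent ends a₂ b)) *
        prob (Function.update p e 1) (avoidAll ends a₂ {a₁} ∩ connEvent ends a₂ o))) := by
    have := mul_nonneg (mul_nonneg (by norm_num : (0 : R) ≤ 2) (sq_nonneg
      (prob (Function.update p e 0) (avoidAll ends a₂ {a₁})))) hB2
    rw [hB2e] at this
    linarith [this]
  have hQH : 0 ≤ prob (Function.update p e 0) (avoidAll ends a₂ {a₁}) * H2 p ends o a₁ a₂ a₃ b e := by
    rw [hsplit]; linarith [hg, hN1, hN2]
  have hQH' : prob (Function.update p e 0) (avoidAll ends a₂ {a₁}) * 0 ≤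
      prob (Function.update p e 0) (avoidAll ends a₂ {a₁}) * H2 p ends o a₁ a₂ a₃ b e := by
    rw [mul_zero]; exact hQH
  exact le_of_mul_le_mul_left hQH' hQ

end Split

end QuarticRootCross

end Summit.Ventures.PercRepro2
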